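import Literature.Algebra.Polynomial.CircuitNumberNonnegativity

/-!
# Tightness of the circuit-number bound: the equalising point (norm minimiser)

[cite: IlimanDewolff2016, §3.2 «Standard Forms and Norm Minimizers of Polynomials Supported on
Circuits» (the norm minimiser `s*` defined by `e^{⟨s*, α(j)⟩} = λ_j / b_j`; Proposition 13: for
`c = −Θ_f` the point `s*` is a root and the global minimiser of `f(e^w)`; Corollary 15); Theorem
3.8 (1) ⇒ (2)]
[cite: ChandrasekaranShah2016, §2.1 (the AM/GM-exponential and the equality case of (i))]

`Literature.Algebra.Polynomial.CircuitNumberNonnegativity` proves the *certificate* direction: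
`−Θ ≤ c` implies that the circuit signomial `g(x) = ∑_j b_j e^{α(j)·x} + c e^{β·x}` is nonnegative.
This file records the converse mechanism used by Iliman–de Wolff: at an **equalising point** `x*`
— a point where every outer term takes its AM/GM share, `b_j e^{α(j)·x*} = λ_j Θ e^{β·x*}` (the norm
minimiser `e^{s*}` of the source, written without the normalisation `b₀ = λ₀, α(0) = 0`) — the
signomial *equals* `(Θ + c) e^{β·x*}`.  Consequently the AM/GM bound
`Θ e^{β·x} ≤ ∑_j b_j e^{α(j)·x}` is attained there, nonnegativity of `g` forces `−Θ ≤ c` (so the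
certificate of the companion file is also necessary), and `g ≥ 0 ↔ −Θ ≤ c` given such a point.
The existence of the equalising point is the linear-algebra fact «the rank of this system has
to be n, since conv(A) is a simplex»; we prove it here in the one-dimensional two-outer-point
case, in closed form — the case exercised by univariate and by binomial-circuit verifiers.
No named facts.  Numbering: «Theorem 3.8» is the journal number (Res. Math. Sci. 3 (2016)) as
quoted by [MagronSeidlerDewolff2019, Theorem 2.1] and used in the companion file; «§3.2»,
«Proposition 13», «Corollary 15» are the numbers of the arXiv text (1402.0462) held in the
literature store, whose flat numbering differs from the journal's.
-/

namespace Literature.Algebra.Polynomial.CircuitNumberTightness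

open Finset Literature.Algebra.Polynomial.CircuitNumberNonnegativity

section General

variable {ι : Type*} [Fintype ι] {n : Type*} [Fintype n]

/-- At an equalising point `x` (every outer term equals its AM/GM share
`b_j e^{α(j)·x} = λ_j Θ e^{β·x}`) the circuit signomial equals `(Θ + c)·e^{β·x}` — the computation
`f(e^{s*}) = ∑_j λ_j − Θ_f ∏ (λ_j/b_j)^{λ_j} = 1 − 1 = 0` of the source for `c = −Θ_f`, kept with a
general inner coefficient `c`.
[cite: IlimanDewolff2016, Proposition 13 (proof, first display)] -/
theorem signomial_eq_at_equalising_point {b w : ι → ℝ} (hw1 : ∑ j, w j = 1) {α : ι → n → ℝ}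
    {β : n → ℝ} (c : ℝ) {x : n → ℝ}
    (heq : ∀ j, b j * Real.exp (dotProduct (α j) x)
      = w j * circuitNumber b w * Real.exp (dotProduct β x)) :
    ∑ j, b j * Real.exp (dotProduct (α j) x) + c * Real.exp (dotProduct β x)
      = (circuitNumber b w + c) * Real.exp (dotProduct β x) := by
  simp_rw [heq]
  rw [← sum_mul, ← sum_mul, hw1, one_mul]
  ring

/-- The AM/GM bound of the companion file in signomial form: `Θ·e^{β·x} ≤ ∑_j b_j e^{α(j)·x}` for
every real `x` (the case `c = −Θ` of `signomial_nonneg_of_neg_circuitNumber_le`).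
[cite: IlimanDewolff2016, Theorem 3.8 (proof: AM/GM step)]
[cite: ChandrasekaranShah2016, §2.1, (i)–(ii)] -/
theorem circuitNumber_mul_exp_le {b w : ι → ℝ} (hb : ∀ j, 0 ≤ b j) (hw : ∀ j, 0 ≤ w j)
    (hw1 : ∑ j, w j = 1) {α : ι → n → ℝ} {β : n → ℝ} (hβ : ∀ i, β i = ∑ j, w j * α j i)
    (x : n → ℝ) :
    circuitNumber b w * Real.exp (dotProduct β x) ≤ ∑ j, b j * Real.exp (dotProduct (α j) x) := by
  have h := signomial_nonneg_of_neg_circuitNumber_le hb hw hw1 hβ (c := -circuitNumber b w)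
    le_rfl x
  linarith

/-- … and the bound is ATTAINED at an equalising point: `Θ·e^{β·x*} = ∑_j b_j e^{α(j)·x*}`, i.e.
`e^{s*}` minimises `(f / x^y)(e^w)` / is the global minimiser of the source.
[cite: IlimanDewolff2016, Proposition 13 and Corollary 15 («e^{s*} is a global minimizer for
(f / x^y)(e^w) independent of the choice of c»)] -/
theorem circuitNumber_mul_exp_eq_at_equalising_point {b w : ι → ℝ} (hw1 : ∑ j, w j = 1)
    {α : ι → n → ℝ} {β : n → ℝ} {x : n → ℝ}
    (heq : ∀ j, b j * Real.exp (dotProduct (α j) x)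
      = w j * circuitNumber b w * Real.exp (dotProduct β x)) :
    circuitNumber b w * Real.exp (dotProduct β x) = ∑ j, b j * Real.exp (dotProduct (α j) x) := by
  have h := signomial_eq_at_equalising_point hw1 0 heq
  simp only [zero_mul, add_zero] at h
  exact h.symm

/-- **Necessity of the circuit condition** (Iliman–de Wolff Theorem 3.8 (1) ⇒ (2), signomial
form): if the circuit signomial is nonnegative on `ℝⁿ` and an equalising point exists, then
`−Θ ≤ c` — for `c < −Θ` the value at the equalising point is `(Θ + c) e^{β·x*} < 0`.
[cite: IlimanDewolff2016, Theorem 3.8, (1) ⇒ (2) (via Proposition 13)] -/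
theorem neg_circuitNumber_le_of_signomial_nonneg {b w : ι → ℝ} (hw1 : ∑ j, w j = 1)
    {α : ι → n → ℝ} {β : n → ℝ} {c : ℝ}
    (hex : ∃ x : n → ℝ, ∀ j, b j * Real.exp (dotProduct (α j) x)
      = w j * circuitNumber b w * Real.exp (dotProduct β x))
    (hg : ∀ x : n → ℝ,
      0 ≤ ∑ j, b j * Real.exp (dotProduct (α j) x) + c * Real.exp (dotProduct β x)) :
    -circuitNumber b w ≤ c := by
  obtain ⟨x, hx⟩ := hex
  have h := hg x
  rw [signomial_eq_at_equalising_point hw1 c hx] at h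
  have hE := Real.exp_pos (dotProduct β x)
  have h' := (mul_nonneg_iff_of_pos_right hE).mp h
  linarith

/-- **Characterisation given an equalising point** («`f(e^w) ≥ 0` iff `c ≥ −Θ_f`»): combining the
certificate direction of the companion file with the necessity above.
[cite: IlimanDewolff2016, Theorem 3.8, (1) ⇔ (2) (signomial form, on the positive orthant)]
[cite: ChandrasekaranShah2016, §2.1] -/
theorem signomial_nonneg_iff_of_equalising_point {b w : ι → ℝ} (hb : ∀ j, 0 ≤ b j)
    (hw : ∀ j, 0 ≤ w j) (hw1 : ∑ j, w j = 1) {α : ι → n → ℝ} {β : n → ℝ}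
    (hβ : ∀ i, β i = ∑ j, w j * α j i) {c : ℝ}
    (hex : ∃ x : n → ℝ, ∀ j, b j * Real.exp (dotProduct (α j) x)
      = w j * circuitNumber b w * Real.exp (dotProduct β x)) :
    (∀ x : n → ℝ, 0 ≤ ∑ j, b j * Real.exp (dotProduct (α j) x) + c * Real.exp (dotProduct β x))
      ↔ -circuitNumber b w ≤ c :=
  ⟨neg_circuitNumber_le_of_signomial_nonneg hw1 hex,
    fun hc x => signomial_nonneg_of_neg_circuitNumber_le hb hw hw1 hβ hc x⟩

end General

/-! ## Existence of the equalising point: one dimension, two outer points -/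

section OneDim

/-- The logarithmic identity behind the circuit number: for positive data,
`w₀ log(w₀Θ/b₀) + w₁ log(w₁Θ/b₁) = 0` where `Θ = (b₀/w₀)^{w₀} (b₁/w₁)^{w₁}` and `w₀ + w₁ = 1` —
the consistency of the linear system defining `s*` («application of log|·| on both sides yields a
linear system of equations»).
[cite: IlimanDewolff2016, §3.2 (definition of the norm minimiser s*, well-definedness)] -/
theorem weighted_log_share_sum_eq_zero {b₀ b₁ w₀ w₁ : ℝ} (hb₀ : 0 < b₀) (hb₁ : 0 < b₁)
    (hw₀ : 0 < w₀) (hw₁ : 0 < w₁) (hsum : w₀ + w₁ = 1) :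
    w₀ * Real.log (w₀ * ((b₀ / w₀) ^ w₀ * (b₁ / w₁) ^ w₁) / b₀)
      + w₁ * Real.log (w₁ * ((b₀ / w₀) ^ w₀ * (b₁ / w₁) ^ w₁) / b₁) = 0 := by
  set Θ := (b₀ / w₀) ^ w₀ * (b₁ / w₁) ^ w₁ with hΘ_def
  have hq₀ : 0 < b₀ / w₀ := div_pos hb₀ hw₀
  have hq₁ : 0 < b₁ / w₁ := div_pos hb₁ hw₁
  have hΘ : 0 < Θ := mul_pos (Real.rpow_pos_of_pos hq₀ _) (Real.rpow_pos_of_pos hq₁ _)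
  have hlogΘ : Real.log Θ
      = w₀ * (Real.log b₀ - Real.log w₀) + w₁ * (Real.log b₁ - Real.log w₁) := by
    rw [hΘ_def, Real.log_mul (Real.rpow_pos_of_pos hq₀ _).ne' (Real.rpow_pos_of_pos hq₁ _).ne',
      Real.log_rpow hq₀, Real.log_rpow hq₁, Real.log_div hb₀.ne' hw₀.ne',
      Real.log_div hb₁.ne' hw₁.ne']
  have h₀ : Real.log (w₀ * Θ / b₀) = Real.log w₀ + Real.log Θ - Real.log b₀ := by
    rw [Real.log_div (mul_pos hw₀ hΘ).ne' hb₀.ne', Real.log_mul hw₀.ne' hΘ.ne']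
  have h₁ : Real.log (w₁ * Θ / b₁) = Real.log w₁ + Real.log Θ - Real.log b₁ := by
    rw [Real.log_div (mul_pos hw₁ hΘ).ne' hb₁.ne', Real.log_mul hw₁.ne' hΘ.ne']
  rw [h₀, h₁, hlogΘ]
  have : w₁ = 1 - w₀ := by linarith
  subst this
  ring

/-- **Existence of the equalising point in dimension one** (two outer exponents `α₀ ≠ α₁`, inner
exponent `β = w₀α₀ + w₁α₁` strictly between them, positive coefficients): the point
`x* = log(w₁Θ/b₁) / (α₁ − β)` satisfies both share equations `b_j e^{α_j x*} = w_j Θ e^{β x*}`.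
This is the solvability of the source's linear system for `s*` in the simplest circuit.
[cite: IlimanDewolff2016, §3.2 (norm minimiser s*: «the rank of this system has to be n, since
conv(A) is a simplex») and Proposition 13] -/
theorem exists_equalising_point_one_dim {b₀ b₁ w₀ w₁ α₀ α₁ β : ℝ} (hb₀ : 0 < b₀) (hb₁ : 0 < b₁)
    (hw₀ : 0 < w₀) (hw₁ : 0 < w₁) (hsum : w₀ + w₁ = 1) (hne : α₀ ≠ α₁)
    (hβ : β = w₀ * α₀ + w₁ * α₁) :
    ∃ x : ℝ,
      b₀ * Real.exp (α₀ * x) = w₀ * ((b₀ / w₀) ^ w₀ * (b₁ / w₁) ^ w₁) * Real.exp (β * x) ∧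
      b₁ * Real.exp (α₁ * x) = w₁ * ((b₀ / w₀) ^ w₀ * (b₁ / w₁) ^ w₁) * Real.exp (β * x) := by
  set Θ := (b₀ / w₀) ^ w₀ * (b₁ / w₁) ^ w₁ with hΘ_def
  have hΘ : 0 < Θ :=
    mul_pos (Real.rpow_pos_of_pos (div_pos hb₀ hw₀) _) (Real.rpow_pos_of_pos (div_pos hb₁ hw₁) _)
  -- the two log-shares and their consistency
  set L₀ := Real.log (w₀ * Θ / b₀) with hL₀_def
  set L₁ := Real.log (w₁ * Θ / b₁) with hL₁_def
  have hL : w₀ * L₀ + w₁ * L₁ = 0 := weighted_log_share_sum_eq_zero hb₀ hb₁ hw₀ hw₁ hsum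
  have hd₁ : α₁ - β = w₀ * (α₁ - α₀) := by
    rw [hβ]; have : w₁ = 1 - w₀ := by linarith
    subst this; ring
  have hd₀ : α₀ - β = -(w₁ * (α₁ - α₀)) := by
    rw [hβ]; have : w₀ = 1 - w₁ := by linarith
    subst this; ring
  have hα : α₁ - α₀ ≠ 0 := sub_ne_zero.mpr (Ne.symm hne)
  have hd₁ne : α₁ - β ≠ 0 := by rw [hd₁]; exact mul_ne_zero hw₀.ne' hα
  refine ⟨L₁ / (α₁ - β), ?_, ?_⟩
  · -- outer point 0: (α₀ − β)·x* = −(w₁/w₀)·L₁ = L₀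
    have hx : (α₀ - β) * (L₁ / (α₁ - β)) = L₀ := by
      rw [hd₀, hd₁]
      have h1 : -(w₁ * (α₁ - α₀)) * (L₁ / (w₀ * (α₁ - α₀))) = -(w₁ * L₁) / w₀ := by
        rw [← mul_div_assoc, show -(w₁ * (α₁ - α₀)) * L₁ = -(w₁ * L₁) * (α₁ - α₀) by ring,
          mul_div_mul_right _ _ hα]
      rw [h1, eq_comm, eq_div_iff hw₀.ne']
      linarith
    have hE₀ : Real.exp L₀ = w₀ * Θ / b₀ := by
      rw [hL₀_def, Real.exp_log (div_pos (mul_pos hw₀ hΘ) hb₀)]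
    rw [show α₀ * (L₁ / (α₁ - β)) = β * (L₁ / (α₁ - β)) + (α₀ - β) * (L₁ / (α₁ - β)) by ring,
      Real.exp_add, hx, hE₀]
    field_simp
  · -- outer point 1: (α₁ − β)·x* = L₁ by definition
    have hx : (α₁ - β) * (L₁ / (α₁ - β)) = L₁ := mul_div_cancel₀ L₁ hd₁ne
    have hE₁ : Real.exp L₁ = w₁ * Θ / b₁ := by
      rw [hL₁_def, Real.exp_log (div_pos (mul_pos hw₁ hΘ) hb₁)]
    rw [show α₁ * (L₁ / (α₁ - β)) = β * (L₁ / (α₁ - β)) + (α₁ - β) * (L₁ / (α₁ - β)) by ring,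
      Real.exp_add, hx, hE₁]
    field_simp

/-- The closed form of the circuit number for two outer points, `Θ = (b₀/w₀)^{w₀} (b₁/w₁)^{w₁}`,
as the special case of `circuitNumber` over `Fin 2` (so that the one-dimensional existence statement
feeds `signomial_nonneg_iff_of_equalising_point`).
[cite: IlimanDewolff2016, circuit number Θ_f (Introduction, the display defining Θ_f)] -/
theorem circuitNumber_fin_two (b₀ b₁ w₀ w₁ : ℝ) :
    circuitNumber ![b₀, b₁] ![w₀, w₁] = (b₀ / w₀) ^ w₀ * (b₁ / w₁) ^ w₁ := by
  simp [circuitNumber, Fin.prod_univ_two]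

end OneDim

end Literature.Algebra.Polynomial.CircuitNumberTightness
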